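import Mathlib.MeasureTheory.Measure.Regular
import Mathlib.Analysis.SpecificLimits.Basic
import HarnessLib

/-!
# Lusin's theorem: a measurable map is continuous on closed (compact) sets of almost full measure

Topic `Literature/MeasureTheory/Lusin`.  Fully proved (no definitions, no named facts).  For a finite, weakly regular Borel
measure `μ` on a topological space `X` (e.g. any finite Borel measure on a (pseudo)metrizable space — a Mathlib instance) and a
measurable map `f : X → Y` into a second-countable space:

* `exists_isClosed_compl_lt_continuousOn` — **Lusin's theorem, closed-set form** (Kechris, *Classical Descriptive Set Theory*,
  Thm 17.12; Federer 2.3.5): for every `ε ≠ 0` there is a CLOSED `F` with `μ Fᶜ < ε` and `f` continuous on `F`;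
* `exists_isCompact_compl_lt_continuousOn` — the compact form when `μ` is moreover inner regular by compact sets on finite-measure
  sets (`μ.InnerRegularCompactLTTop`, again automatic on Polish spaces) and `X` is Hausdorff;
* `exists_isCompact_subset_diff_lt_continuousOn` — the localised compact form inside a given measurable set `A`: a compact `K ⊆ A`
  with `μ (A \ K) < ε` and `f` continuous on `K` (the shape used to build compact PESIN SETS on which Lyapunov charts vary
  continuously, Barreira–Pesin 2023 §4.3; consumer: the closing lemma `stub_ambientClosing` of `Summits/AnomalousDissipation`).

Proof (Kechris): fix a countable basis `(vᵢ)` of `Y` and defects `Σ δᵢ < ε/2`; approximate `Aᵢ = f⁻¹ vᵢ` and `Aᵢᶜ` from inside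
by closed `Fᵢ`, `Gᵢ` up to `δᵢ`; on the closed set `F = ⋂ᵢ (Fᵢ ∪ Gᵢ)` each `f⁻¹ vᵢ ∩ F = F \ Gᵢ` is relatively open, so `f|_F`
is continuous, and `μ Fᶜ ≤ Σᵢ 2δᵢ < ε`.  Mathlib (this pin) has the Lusin–Souslin theorem (measurable injective images) and
`Lp`-approximation by continuous functions (`Mathlib.MeasureTheory.Function.ContinuousMapDense`), but not Lusin's continuity
theorem (`lean search "Lusin"`: only Lusin–Souslin).

## References

* A. S. Kechris, *Classical Descriptive Set Theory*, GTM 156, Springer (1995), Thm 17.12. [Kechris1995]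
* H. Federer, *Geometric Measure Theory*, Springer (1969), 2.3.5–2.3.6. [Federer1969]
* L. Barreira, Ya. Pesin, *Introduction to Smooth Ergodic Theory*, 2nd ed., GSM 231, AMS (2023), §4.3 (regular sets).
  [BarreiraPesin2023]
-/

noncomputable section

open Set Filter TopologicalSpace
open _root_.MeasureTheory
open scoped ENNReal Topology

namespace Literature.MeasureTheory.Lusin

variable {X Y : Type*} [TopologicalSpace X] [MeasurableSpace X] [OpensMeasurableSpace X]
  [TopologicalSpace Y] [SecondCountableTopology Y] [MeasurableSpace Y] [OpensMeasurableSpace Y]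
  {μ : Measure X} {f : X → Y}

/-- **Lusin's theorem (closed-set form).**  Let `μ` be a finite, weakly regular Borel measure on a topological space `X` and
`f : X → Y` a measurable map into a second-countable space.  For every `ε ≠ 0` there is a closed set `F` with `μ Fᶜ < ε` on which
`f` is continuous. [folklore] -/
theorem exists_isClosed_compl_lt_continuousOn [IsFiniteMeasure μ] [μ.WeaklyRegular] (hf : Measurable f) {ε : ℝ≥0∞}
    (hε : ε ≠ 0) : ∃ F : Set X, IsClosed F ∧ μ Fᶜ < ε ∧ ContinuousOn f F := by
  rcases isEmpty_or_nonempty Y with hY | hY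
  · exact ⟨univ, isClosed_univ, by simpa [compl_univ] using pos_iff_ne_zero.2 hε, fun x _ => (hY.false (f x)).elim⟩
  obtain ⟨b, hbc, -, hb⟩ := exists_countable_basis Y
  have hbne : b.Nonempty := by
    obtain ⟨y⟩ := hY
    obtain ⟨t, htb, -, -⟩ := hb.exists_subset_of_mem_open (mem_univ y) isOpen_univ
    exact ⟨t, htb⟩
  obtain ⟨v, hv⟩ := hbc.exists_eq_range hbne
  have hvopen : ∀ i, IsOpen (v i) := fun i => hb.isOpen (hv ▸ mem_range_self i)
  -- summable defects `Σ δ i < ε / 2`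
  obtain ⟨δ, hδpos, hδsum⟩ := ENNReal.exists_pos_sum_of_countable' (ENNReal.half_pos hε).ne' ℕ
  -- inner approximation of `f ⁻¹' v i` and of its complement by closed sets
  have hA : ∀ i, MeasurableSet (f ⁻¹' v i) := fun i => hf (hvopen i).measurableSet
  have hF : ∀ i, ∃ F, F ⊆ f ⁻¹' v i ∧ IsClosed F ∧ μ (f ⁻¹' v i \ F) < δ i := fun i =>
    (hA i).exists_isClosed_sdiff_lt (measure_ne_top μ _) (hδpos i).ne'
  have hG : ∀ i, ∃ G, G ⊆ (f ⁻¹' v i)ᶜ ∧ IsClosed G ∧ μ ((f ⁻¹' v i)ᶜ \ G) < δ i := fun i =>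
    (hA i).compl.exists_isClosed_sdiff_lt (measure_ne_top μ _) (hδpos i).ne'
  choose F hFA hFc hFμ using hF
  choose G hGA hGc hGμ using hG
  refine ⟨⋂ i, (F i ∪ G i), isClosed_iInter fun i => (hFc i).union (hGc i), ?_, ?_⟩
  · -- measure of the complement
    have hi : ∀ i, μ (F i ∪ G i)ᶜ ≤ δ i + δ i := fun i =>
      calc μ (F i ∪ G i)ᶜ ≤ μ ((f ⁻¹' v i \ F i) ∪ ((f ⁻¹' v i)ᶜ \ G i)) := by
            refine measure_mono fun x hx => ?_
            simp only [mem_compl_iff, mem_union, not_or] at hx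
            by_cases hxA : x ∈ f ⁻¹' v i
            · exact Or.inl ⟨hxA, hx.1⟩
            · exact Or.inr ⟨hxA, hx.2⟩
        _ ≤ μ (f ⁻¹' v i \ F i) + μ ((f ⁻¹' v i)ᶜ \ G i) := measure_union_le _ _
        _ ≤ δ i + δ i := add_le_add (hFμ i).le (hGμ i).le
    rw [compl_iInter]
    calc μ (⋃ i, (F i ∪ G i)ᶜ) ≤ ∑' i, μ (F i ∪ G i)ᶜ := measure_iUnion_le _
      _ ≤ ∑' i, (δ i + δ i) := ENNReal.tsum_le_tsum hi
      _ = ∑' i, δ i + ∑' i, δ i := ENNReal.tsum_add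
      _ < ε / 2 + ε / 2 := ENNReal.add_lt_add hδsum hδsum
      _ = ε := ENNReal.add_halves ε
  · -- continuity on `⋂ i, (F i ∪ G i)`: `f ⁻¹' v i` is relatively open there (`= · \ G i`)
    intro x hx
    rw [ContinuousWithinAt, tendsto_def]
    intro s hs
    obtain ⟨t, htb, hxt, hts⟩ := hb.mem_nhds_iff.1 hs
    obtain ⟨i, rfl⟩ : ∃ i, v i = t := by rw [hv] at htb; exact htb
    have hxG : x ∉ G i := fun h' => hGA i h' hxt
    have hmem : (⋂ i, (F i ∪ G i)) ∩ (G i)ᶜ ∈ 𝓝[⋂ i, (F i ∪ G i)] x :=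
      inter_mem_nhdsWithin _ ((hGc i).isOpen_compl.mem_nhds hxG)
    refine mem_of_superset hmem fun x' hx' => ?_
    have h1 : x' ∈ F i ∪ G i := mem_iInter.1 hx'.1 i
    exact hts (hFA i (h1.resolve_right hx'.2))

/-- **Lusin's theorem (compact form).**  If moreover `X` is Hausdorff and `μ` is inner regular by compact sets on sets of finite
measure (automatic for finite Borel measures on Polish spaces), then for every `ε ≠ 0` there is a COMPACT `K` with `μ Kᶜ < ε` on
which `f` is continuous. [folklore] -/
theorem exists_isCompact_compl_lt_continuousOn [T2Space X] [IsFiniteMeasure μ] [μ.WeaklyRegular] [μ.InnerRegularCompactLTTop]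
    (hf : Measurable f) {ε : ℝ≥0∞} (hε : ε ≠ 0) :
    ∃ K : Set X, IsCompact K ∧ μ Kᶜ < ε ∧ ContinuousOn f K := by
  obtain ⟨F, hFc, hFμ, hFcont⟩ := exists_isClosed_compl_lt_continuousOn (μ := μ) hf (ENNReal.half_pos hε).ne'
  obtain ⟨K, -, hKc, hKμ⟩ := MeasurableSet.univ.exists_isCompact_sdiff_lt (measure_ne_top μ _) (ENNReal.half_pos hε).ne'
  refine ⟨K ∩ F, hKc.inter_right hFc, ?_, hFcont.mono inter_subset_right⟩
  calc μ (K ∩ F)ᶜ = μ (Kᶜ ∪ Fᶜ) := by rw [compl_inter]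
    _ ≤ μ Kᶜ + μ Fᶜ := measure_union_le _ _
    _ < ε / 2 + ε / 2 := ENNReal.add_lt_add (by rwa [compl_eq_univ_sdiff]) hFμ
    _ = ε := ENNReal.add_halves ε

/-- **Lusin's theorem inside a measurable set (compact form).**  Under the same hypotheses, for every measurable `A` and `ε ≠ 0` there
is a compact `K ⊆ A` with `μ (A \ K) < ε` on which `f` is continuous. [folklore] -/
theorem exists_isCompact_subset_diff_lt_continuousOn [T2Space X] [IsFiniteMeasure μ] [μ.WeaklyRegular]
    [μ.InnerRegularCompactLTTop] (hf : Measurable f) {A : Set X} (hA : MeasurableSet A) {ε : ℝ≥0∞} (hε : ε ≠ 0) :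
    ∃ K : Set X, K ⊆ A ∧ IsCompact K ∧ μ (A \ K) < ε ∧ ContinuousOn f K := by
  obtain ⟨F, hFc, hFμ, hFcont⟩ := exists_isClosed_compl_lt_continuousOn (μ := μ) hf (ENNReal.half_pos hε).ne'
  obtain ⟨K, hKA, hKc, hKμ⟩ := hA.exists_isCompact_sdiff_lt (measure_ne_top μ _) (ENNReal.half_pos hε).ne'
  refine ⟨K ∩ F, inter_subset_left.trans hKA, hKc.inter_right hFc, ?_, hFcont.mono inter_subset_right⟩
  calc μ (A \ (K ∩ F)) ≤ μ ((A \ K) ∪ Fᶜ) := by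
        refine measure_mono fun x hx => ?_
        by_cases hxK : x ∈ K
        · exact Or.inr fun hxF => hx.2 ⟨hxK, hxF⟩
        · exact Or.inl ⟨hx.1, hxK⟩
    _ ≤ μ (A \ K) + μ Fᶜ := measure_union_le _ _
    _ < ε / 2 + ε / 2 := ENNReal.add_lt_add hKμ hFμ
    _ = ε := ENNReal.add_halves ε

end Literature.MeasureTheory.Lusin

end
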